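import Literature.Probability.LatticeModels.StrongHarrisKleitman
import Literature.Probability.Percolation.StrongHarrisThreePoint
import Summits.CriticalPhenomena.PercolationContinuityZ3.Theorems.PercNearOneGluingNoHeavyLowerTailStrongHarrisCubicStep
import HarnessLib

/-!
# `NoHeavyLowerTail` (stmt-CriticalPhenomena-4575) — the cubic strong-Harris row G3 = AG⁺ for ALL product measures, CONDITIONAL on
"Conjecture M" (the slice-pair inequality), by Gladkov's coordinate induction

Support file (prover prim-ineq-gen-4 gen 4; `--supports stmt-CriticalPhenomena-4575`).  Companion of
`…StrongHarrisCubicStep` (the twelve-type algebra) and of the tree's formalisation of Gladkov 2024 BLMS Thm. 2.1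
(`Literature.Probability.LatticeModels.StrongHarris.core`, whose section machinery is reused verbatim).

SETTING (as in Gladkov's Thm. 2.1, three middle cells): `μ = prodBernoulli p` on `Set ι`, cylinder events `A, C₀, C₁, C₂` over a
finite coordinate set `F`, the `C i` pairwise disjoint and disjoint from `A`, `A` and every `A ∪ C i` closed upwards,
`B := (A ∪ ⋃ C i)ᶜ`.  The CUBIC ROW is `G3(μA; μC₀, μC₁, μC₂; μB) = μ(A)μ(B) − e₂(μC) − e₃(μC) ≥ 0` (for the three-point
percolation cells this is `AG⁺ = qt − e₂(u) − e₃(u) ≥ 0`, which implies SHK3⁺).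

KEY ALGEBRAIC FACT (`sliceBernstein`, by `ring`): along one coordinate `e` of weight `π`, with `ℓ⁰ = (a; c; b)` the law of the
lower sections and `ℓ¹ = (a'; c'; b')` the law of the upper sections, `G3((1−π)ℓ⁰ + πℓ¹)` is the cubic with Bernstein coefficients
`G3(ℓ⁰)`, `(G3(ℓ⁰) + sliceP₁)/3`, `(G3(ℓ¹) + sliceP₂)/3`, `G3(ℓ¹)`, where `sliceP₁, sliceP₂` are EXPLICIT cubic polynomials in the two
slice laws alone:  `sliceP₂(ℓ⁰,ℓ¹) = G3(ℓ⁰) + G3(ℓ¹) − (a'−a)(b'−b) + e₂(δ) + Σ_j c_j δ_i δ_k + 2 δ₁δ₂δ₃`, `δ = c' − c`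
(and `sliceP₁` with `+ δ₁δ₂δ₃`); on actual sections these are the `P₁, P₂` of `…StrongHarrisCubicStep` (`sliceP₂_eq_P₂`).

CONJECTURE M (abstract form) = `CubicSliceStep p` := for every such system and every coordinate `e`, the two section laws satisfy
`sliceP₁ ≥ 0` and `sliceP₂ ≥ 0` (equivalently: `G3(law)/π_e²` is non-increasing and `G3/(1−π_e)²` non-decreasing in the single weight
`π_e`; 0 violations in ≈ 2·10⁵ abstract and 1 640 exact percolation instances, memo
run/shared/lean/prim/prim-ineq-gen-4/FINDING-ONESTEP-NOGO-AND-CONJ-M-g4.md; NOT provable from the slice rows + four-functions alone —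
exact fake coupling in `…StrongHarrisCubicStep`).

THEOREM (`strongHarris_cubic_of_sliceStep`): `CubicSliceStep p → G3 ≥ 0` for every system of cylinder events (and, for finite `ι`,
for every system: `prodBernoulli_strongHarris_cubic_of_sliceStep`).  Proof = Gladkov's induction on `F`: base case trivial (all
events `∅`/`univ`, at most one middle cell non-empty); step = one-coordinate decomposition `μX = π μX¹ + (1−π) μX⁰`
(`StrongHarris.real_eq_preimage_insert_add_preimage_sdiff`), the induction hypothesis for the two section systems, Conjecture M for the
pair, and `sliceBernstein` + `bernstein_cubic_nonneg`.
[cite: Gladkov2024StrongFKG, Thm. 2.1 and its proof (induction on the coordinates; the quadratic analogue)]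
-/

noncomputable section

namespace Summit.CriticalPhenomena.PercolationContinuityZ3.Theorems

namespace StrongHarrisCubicStep

open MeasureTheory Measure Literature.Probability.Percolation Literature.Probability.LatticeModels
  Literature.Probability.LatticeModels.StrongHarris
open scoped ENNReal

/-! ### Algebra: the slice-pair polynomials and the Bernstein identity -/

section Algebra

variable {R : Type*} [CommRing R]

/-- `sliceP₁(ℓ⁰, ℓ¹) = G3(ℓ⁰) + G3(ℓ¹) − (a'−a)(b'−b) + e₂(δ) + Σ_j c_j δ_iδ_k + δ₁δ₂δ₃`, `δ = c' − c`
(three times the first Bernstein coefficient minus `G3(ℓ⁰)`). [folklore] -/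
def sliceP₁ (a c₁ c₂ c₃ b a' c₁' c₂' c₃' b' : R) : R :=
  G3 a c₁ c₂ c₃ b + G3 a' c₁' c₂' c₃' b' - (a' - a) * (b' - b) +
    ((c₁' - c₁) * (c₂' - c₂) + (c₁' - c₁) * (c₃' - c₃) + (c₂' - c₂) * (c₃' - c₃)) +
    (c₁ * ((c₂' - c₂) * (c₃' - c₃)) + c₂ * ((c₁' - c₁) * (c₃' - c₃)) + c₃ * ((c₁' - c₁) * (c₂' - c₂))) +
    (c₁' - c₁) * (c₂' - c₂) * (c₃' - c₃)

/-- `sliceP₂(ℓ⁰, ℓ¹) = G3(ℓ⁰) + G3(ℓ¹) − (a'−a)(b'−b) + e₂(δ) + Σ_j c_j δ_iδ_k + 2 δ₁δ₂δ₃`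
(three times the second Bernstein coefficient minus `G3(ℓ¹)`). [folklore] -/
def sliceP₂ (a c₁ c₂ c₃ b a' c₁' c₂' c₃' b' : R) : R :=
  G3 a c₁ c₂ c₃ b + G3 a' c₁' c₂' c₃' b' - (a' - a) * (b' - b) +
    ((c₁' - c₁) * (c₂' - c₂) + (c₁' - c₁) * (c₃' - c₃) + (c₂' - c₂) * (c₃' - c₃)) +
    (c₁ * ((c₂' - c₂) * (c₃' - c₃)) + c₂ * ((c₁' - c₁) * (c₃' - c₃)) + c₃ * ((c₁' - c₁) * (c₂' - c₂))) +
    2 * ((c₁' - c₁) * (c₂' - c₂) * (c₃' - c₃))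

/-- **Bernstein identity along one coordinate, slice-law form.**  For ANY two vectors `ℓ⁰ = (a;c;b)`, `ℓ¹ = (a';c';b')` and
weight `π`: `G3(π ℓ¹ + (1−π) ℓ⁰) = G3(ℓ⁰)(1−π)³ + (G3(ℓ⁰)+sliceP₁)(1−π)²π + (G3(ℓ¹)+sliceP₂)(1−π)π² + G3(ℓ¹)π³`.
[cite: Gladkov2024StrongFKG, proof of Thm. 2.1 (quadratic part)] -/
theorem sliceBernstein (a c₁ c₂ c₃ b a' c₁' c₂' c₃' b' π : R) :
    G3 (π * a' + (1 - π) * a) (π * c₁' + (1 - π) * c₁) (π * c₂' + (1 - π) * c₂) (π * c₃' + (1 - π) * c₃)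
        (π * b' + (1 - π) * b) =
      G3 a c₁ c₂ c₃ b * (1 - π) ^ 3 +
        (G3 a c₁ c₂ c₃ b + sliceP₁ a c₁ c₂ c₃ b a' c₁' c₂' c₃' b') * ((1 - π) ^ 2 * π) +
        (G3 a' c₁' c₂' c₃' b' + sliceP₂ a c₁ c₂ c₃ b a' c₁' c₂' c₃' b') * ((1 - π) * π ^ 2) +
        G3 a' c₁' c₂' c₃' b' * π ^ 3 := by
  simp only [sliceP₁, sliceP₂, G3]
  ring

/-- On actual sections (`ℓ⁰ = (a₀; o+q; b₀+d+Σm)`, `ℓ¹ = (a₀+d+Σq; o+m; b₀)`) the slice-pair polynomial `sliceP₂` IS the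
twelve-type polynomial `P₂` of `…StrongHarrisCubicStep` (and likewise `sliceP₁ = P₁`). [folklore] -/
theorem sliceP₂_eq_P₂ (a₀ b₀ d q₁ q₂ q₃ o₁ o₂ o₃ m₁ m₂ m₃ : R) :
    sliceP₂ a₀ (o₁ + q₁) (o₂ + q₂) (o₃ + q₃) (b₀ + d + m₁ + m₂ + m₃)
        (a₀ + d + q₁ + q₂ + q₃) (o₁ + m₁) (o₂ + m₂) (o₃ + m₃) b₀ =
      P₂ a₀ b₀ d q₁ q₂ q₃ o₁ o₂ o₃ m₁ m₂ m₃ ∧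
    sliceP₁ a₀ (o₁ + q₁) (o₂ + q₂) (o₃ + q₃) (b₀ + d + m₁ + m₂ + m₃)
        (a₀ + d + q₁ + q₂ + q₃) (o₁ + m₁) (o₂ + m₂) (o₃ + m₃) b₀ =
      P₁ a₀ b₀ d q₁ q₂ q₃ o₁ o₂ o₃ m₁ m₂ m₃ := by
  constructor
  · simp only [sliceP₂, P₂, F₀, F₁, M, S₂, S₃, G3]; ring
  · simp only [sliceP₁, P₁, F₀, F₁, M, S₂, S₃, G3]; ring

/-- **The step.**  `G3(ℓ⁰), G3(ℓ¹) ≥ 0` (induction hypotheses) and `sliceP₁, sliceP₂ ≥ 0` (Conjecture M for the pair) give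
`G3 ≥ 0` for every mixture `π ℓ¹ + (1−π) ℓ⁰`, `π ∈ [0,1]`. [folklore] -/
theorem G3_slice_nonneg {a c₁ c₂ c₃ b a' c₁' c₂' c₃' b' π : ℝ} (h₀ : 0 ≤ G3 a c₁ c₂ c₃ b)
    (h₁ : 0 ≤ G3 a' c₁' c₂' c₃' b') (hP₁ : 0 ≤ sliceP₁ a c₁ c₂ c₃ b a' c₁' c₂' c₃' b')
    (hP₂ : 0 ≤ sliceP₂ a c₁ c₂ c₃ b a' c₁' c₂' c₃' b') (hπ₀ : 0 ≤ π) (hπ₁ : π ≤ 1) :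
    0 ≤ G3 (π * a' + (1 - π) * a) (π * c₁' + (1 - π) * c₁) (π * c₂' + (1 - π) * c₂) (π * c₃' + (1 - π) * c₃)
        (π * b' + (1 - π) * b) := by
  rw [sliceBernstein]
  exact CubicThreePointStep.bernstein_cubic_nonneg h₀ (by linarith) (by linarith) h₁ hπ₀ hπ₁

end Algebra

/-! ### Conjecture M, abstract form, and the conditional theorem -/

variable {ι : Type*}

/-- **CONJECTURE M (abstract slice-pair form).**  For `μ = prodBernoulli p`: for every finite coordinate set `F`, coordinate `e`,
and every Gladkov system `(A, C₀, C₁, C₂, B)` of cylinder events over `F` (cells `C i` pairwise disjoint and disjoint from `A`, `A` and all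
`A ∪ C i` closed upwards, `B` the complement), the laws `ℓ¹ = (μA¹; μCᵢ¹; μB¹)`, `ℓ⁰ = (μA⁰; μCᵢ⁰; μB⁰)` of the upper / lower sections along
`e` (`X¹ = insert e ⁻¹' X`, `X⁰ = (· ∖ {e}) ⁻¹' X`) satisfy `sliceP₁(ℓ⁰,ℓ¹) ≥ 0` and `sliceP₂(ℓ⁰,ℓ¹) ≥ 0`.  Equivalently (memo):
`π ↦ G3(law with p_e = π)/π²` is non-increasing and `G3/(1−π)²` non-decreasing; its Bernstein coefficients satisfy `β₁ ≥ β₀/3`,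
`β₂ ≥ β₃/3`.  Evidence and the exact obstruction to the 'slice rows + four-functions' proof route:
run/shared/lean/prim/prim-ineq-gen-4/FINDING-ONESTEP-NOGO-AND-CONJ-M-g4.md. [folklore] -/
def CubicSliceStep (p : ι → unitInterval) : Prop :=
  ∀ (F : Finset ι) (e : ι) (A B : Set (Set ι)) (C : Fin 3 → Set (Set ι)),
    (∀ i j, i ≠ j → Disjoint (C i) (C j)) → (∀ i, Disjoint A (C i)) →
    (∀ i, IsUpperSet (A ∪ C i)) → IsUpperSet A →
    (∀ ω, ω ∈ B ↔ ω ∉ A ∧ ∀ i, ω ∉ C i) →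
    DeterminedBy A (↑F : Set ι) → (∀ i, DeterminedBy (C i) (↑F : Set ι)) →
    0 ≤ sliceP₁ ((prodBernoulli p).real ((· \ {e}) ⁻¹' A)) ((prodBernoulli p).real ((· \ {e}) ⁻¹' C 0))
        ((prodBernoulli p).real ((· \ {e}) ⁻¹' C 1)) ((prodBernoulli p).real ((· \ {e}) ⁻¹' C 2))
        ((prodBernoulli p).real ((· \ {e}) ⁻¹' B))
        ((prodBernoulli p).real (insert e ⁻¹' A)) ((prodBernoulli p).real (insert e ⁻¹' C 0))
        ((prodBernoulli p).real (insert e ⁻¹' C 1)) ((prodBernoulli p).real (insert e ⁻¹' C 2))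
        ((prodBernoulli p).real (insert e ⁻¹' B)) ∧
    0 ≤ sliceP₂ ((prodBernoulli p).real ((· \ {e}) ⁻¹' A)) ((prodBernoulli p).real ((· \ {e}) ⁻¹' C 0))
        ((prodBernoulli p).real ((· \ {e}) ⁻¹' C 1)) ((prodBernoulli p).real ((· \ {e}) ⁻¹' C 2))
        ((prodBernoulli p).real ((· \ {e}) ⁻¹' B))
        ((prodBernoulli p).real (insert e ⁻¹' A)) ((prodBernoulli p).real (insert e ⁻¹' C 0))
        ((prodBernoulli p).real (insert e ⁻¹' C 1)) ((prodBernoulli p).real (insert e ⁻¹' C 2))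
        ((prodBernoulli p).real (insert e ⁻¹' B))

/-- **The cubic strong-Harris inequality for cylinder events, conditional on Conjecture M** — the core statement proved by
Gladkov's induction on the set `F` of coordinates: for every system `(A, (C i)_{i<3}, B)` of cylinder events over `F` as in
Thm. 2.1, `0 ≤ G3(μA; μC₀, μC₁, μC₂; μB) = μ(A)μ(B) − e₂(μC) − e₃(μC)`.
[cite: Gladkov2024StrongFKG, Thm. 2.1 and its proof (the induction; quadratic analogue)] -/
theorem strongHarris_cubic_of_sliceStep [DecidableEq ι] (p : ι → unitInterval) (hM : CubicSliceStep p)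
    (F : Finset ι) :
    ∀ (A B : Set (Set ι)) (C : Fin 3 → Set (Set ι)),
      (∀ i j, i ≠ j → Disjoint (C i) (C j)) → (∀ i, Disjoint A (C i)) →
      (∀ i, IsUpperSet (A ∪ C i)) → IsUpperSet A →
      (∀ ω, ω ∈ B ↔ ω ∉ A ∧ ∀ i, ω ∉ C i) →
      DeterminedBy A (↑F : Set ι) → (∀ i, DeterminedBy (C i) (↑F : Set ι)) →
      0 ≤ G3 ((prodBernoulli p).real A) ((prodBernoulli p).real (C 0)) ((prodBernoulli p).real (C 1))
        ((prodBernoulli p).real (C 2)) ((prodBernoulli p).real B) := by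
  set μ := prodBernoulli p with hμ
  induction F using Finset.induction_on with
  | empty =>
    intro A B C hdisj hdisjA hup hupA hB hA hC
    -- every event is `∅` or `univ`; two distinct middle cells cannot both be `univ`
    have triv : ∀ X : Set (Set ι), DeterminedBy X (↑(∅ : Finset ι) : Set ι) →
        X = ∅ ∨ X = Set.univ := by
      intro X hX
      rw [determinedBy_iff] at hX
      by_cases hne : X.Nonempty
      · obtain ⟨ω₀, hω₀⟩ := hne
        exact Or.inr (Set.eq_univ_of_forall fun ω => (hX ω ω₀ (by simp)).2 hω₀)
      · exact Or.inl (Set.not_nonempty_iff_eq_empty.1 hne)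
    have hprod : ∀ i j, i ≠ j → μ.real (C i) * μ.real (C j) = 0 := by
      intro i j hij
      rcases triv (C i) (hC i) with h | h
      · rw [h, measureReal_empty, zero_mul]
      · have hCj : C j = ∅ := by
          apply Set.eq_empty_of_forall_notMem
          intro ω hω
          exact Set.disjoint_left.1 (hdisj i j hij) (by rw [h]; exact Set.mem_univ ω) hω
        rw [hCj, measureReal_empty, mul_zero]
    have h01 := hprod 0 1 (by decide)
    have h02 := hprod 0 2 (by decide)
    have h12 := hprod 1 2 (by decide)
    have hab : 0 ≤ μ.real A * μ.real B := by positivity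
    have e3 : μ.real (C 0) * μ.real (C 1) * μ.real (C 2) = 0 := by rw [h01, zero_mul]
    simp only [G3]
    linarith
  | insert e F' he ih =>
    intro A B C hdisj hdisjA hup hupA hB hA hC
    -- the sections
    set A₁ := insert e ⁻¹' A with hA₁d
    set A₀ := (· \ {e}) ⁻¹' A with hA₀d
    set B₁ := insert e ⁻¹' B with hB₁d
    set B₀ := (· \ {e}) ⁻¹' B with hB₀d
    set C₁ : Fin 3 → Set (Set ι) := fun i => insert e ⁻¹' C i with hC₁d
    set C₀ : Fin 3 → Set (Set ι) := fun i => (· \ {e}) ⁻¹' C i with hC₀d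
    -- the sections are systems over `F'`
    have hBdet : DeterminedBy B (↑(insert e F') : Set ι) := by
      refine determinedBy_bottom (s := (Finset.univ : Finset (Fin 3))) (C := C) (fun ω => ?_) hA
        (fun i _ => hC i)
      simpa using hB ω
    have hA₁ : DeterminedBy A₁ (↑F' : Set ι) := determinedBy_preimage_insert hA
    have hA₀ : DeterminedBy A₀ (↑F' : Set ι) := determinedBy_preimage_sdiff hA
    have hC₁ : ∀ i, DeterminedBy (C₁ i) (↑F' : Set ι) := fun i => determinedBy_preimage_insert (hC i)
    have hC₀ : ∀ i, DeterminedBy (C₀ i) (↑F' : Set ι) := fun i => determinedBy_preimage_sdiff (hC i)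
    have ih₁ := ih A₁ B₁ C₁ (fun i j hij => (hdisj i j hij).preimage _) (fun i => (hdisjA i).preimage _)
      (fun i => isUpperSet_preimage_insert (hup i)) (isUpperSet_preimage_insert hupA)
      (fun ω => by simpa [hB₁d, hA₁d, hC₁d] using hB (insert e ω)) hA₁ hC₁
    have ih₀ := ih A₀ B₀ C₀ (fun i j hij => (hdisj i j hij).preimage _) (fun i => (hdisjA i).preimage _)
      (fun i => isUpperSet_preimage_sdiff (hup i)) (isUpperSet_preimage_sdiff hupA)
      (fun ω => by simpa [hB₀d, hA₀d, hC₀d] using hB (ω \ {e})) hA₀ hC₀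
    -- Conjecture M for the pair of section laws
    obtain ⟨hP₁, hP₂⟩ := hM (insert e F') e A B C hdisj hdisjA hup hupA hB hA hC
    -- one-coordinate decompositions
    have dA := real_eq_preimage_insert_add_preimage_sdiff p e hA
    have dB := real_eq_preimage_insert_add_preimage_sdiff p e hBdet
    have dC : ∀ i, μ.real (C i) = p e * μ.real (C₁ i) + (1 - p e) * μ.real (C₀ i) := fun i => by
      rw [hμ, real_eq_preimage_insert_add_preimage_sdiff p e (hC i)]
    rw [hμ, dA, dB, ← hμ, dC 0, dC 1, dC 2]
    exact G3_slice_nonneg ih₀ ih₁ hP₁ hP₂ (p e).2.1 (p e).2.2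

/-- **G3 = AG⁺ for every finite product space, conditional on Conjecture M.**  For `μ = prodBernoulli p` on `Set ι` with `ι` finite,
cells `C i` (`i < 3`) pairwise disjoint and disjoint from the up-set `A`, every `A ∪ C i` closed upwards, and `B := (A ∪ ⋃ C i)ᶜ`:
`μ(A) μ(B) − e₂(μ C) − e₃(μ C) ≥ 0`. [cite: Gladkov2024StrongFKG, Thm. 2.1 (cubic sharpening, conditional)] -/
theorem prodBernoulli_strongHarris_cubic_of_sliceStep [Finite ι] (p : ι → unitInterval) (hM : CubicSliceStep p)
    {A : Set (Set ι)} {C : Fin 3 → Set (Set ι)}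
    (hdisj : ∀ i j, i ≠ j → Disjoint (C i) (C j)) (hdisjA : ∀ i, Disjoint A (C i))
    (hup : ∀ i, IsUpperSet (A ∪ C i)) (hA : IsUpperSet A) :
    0 ≤ G3 ((prodBernoulli p).real A) ((prodBernoulli p).real (C 0)) ((prodBernoulli p).real (C 1))
        ((prodBernoulli p).real (C 2)) ((prodBernoulli p).real (A ∪ ⋃ i, C i)ᶜ) := by
  classical
  haveI := Fintype.ofFinite ι
  have hall : ∀ X : Set (Set ι), DeterminedBy X (↑(Finset.univ : Finset ι) : Set ι) := fun X => by
    rw [determinedBy_iff]; intro ω ω' h; simp only [Finset.coe_univ, Set.inter_univ] at h; rw [h]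
  refine strongHarris_cubic_of_sliceStep p hM Finset.univ A _ C hdisj hdisjA hup hA (fun ω => ?_) (hall A)
    fun i => hall (C i)
  simp only [Set.mem_compl_iff, Set.mem_union, Set.mem_iUnion, not_or, not_exists]

/-! ### The percolation corollary: AG⁺ ≥ 0 (hence SHK3⁺) for every weighted graph, conditional on Conjecture M -/

section Percolation

variable {V : Type*} [Finite V]

omit [Finite V] in
/-- Transitivity of `↔`. [folklore] -/
private theorem openConn_trans'' {x y z : V} {ω : BondConfig V} (h₁ : ω ∈ openConn x y)
    (h₂ : ω ∈ openConn y z) : ω ∈ openConn x z :=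
  SimpleGraph.Reachable.trans h₁ h₂

omit [Finite V] in
/-- Symmetry of `↔`. [folklore] -/
private theorem openConn_symm'' {x y : V} {ω : BondConfig V} (h : ω ∈ openConn x y) :
    ω ∈ openConn y x :=
  SimpleGraph.Reachable.symm h

/-- **AG⁺ for bond percolation, conditional on Conjecture M.**  For `μ = prodBernoulli w` on a finite vertex type and three vertices
`a, b, c`, with the three-point cells `t = μ(abc)`, `u₃ = μ(ab|c)`, `u₂ = μ(ac|b)`, `u₁ = μ(bc|a)`, `q = μ(a|b|c)`:
`CubicSliceStep w → 0 ≤ G3(t; u₁,u₂,u₃; q) = qt − e₂(u) − e₃(u)` (= AG⁺ ≥ 0; SHK3⁺ follows since `F = AG⁺ + t·AG`).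
Proof: the percolation cells form a Gladkov system (as in `Literature.Probability.Percolation.prodBernoulli_threePoint_strongHarris`).
[cite: Gladkov2024StrongFKG, Cor. 4.2 (the quadratic analogue)] -/
theorem threePoint_AGplus_of_sliceStep (w : Sym2 V → unitInterval) (hM : CubicSliceStep w) (a b c : V) :
    0 ≤ G3 ((prodBernoulli w).real (openConn a b ∩ openConn a c))
        ((prodBernoulli w).real (openConn b c ∩ (openConn a b)ᶜ))
        ((prodBernoulli w).real (openConn a c ∩ (openConn a b)ᶜ))
        ((prodBernoulli w).real (openConn a b ∩ (openConn a c)ᶜ))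
        ((prodBernoulli w).real ((openConn a b)ᶜ ∩ (openConn a c)ᶜ ∩ (openConn b c)ᶜ)) := by
  classical
  set A : Set (BondConfig V) := openConn a b ∩ openConn a c with hA
  set C₀ : Set (BondConfig V) := openConn b c ∩ (openConn a b)ᶜ with hC₀
  set C₁ : Set (BondConfig V) := openConn a c ∩ (openConn a b)ᶜ with hC₁
  set C₂ : Set (BondConfig V) := openConn a b ∩ (openConn a c)ᶜ with hC₂
  have d01 : Disjoint C₀ C₁ :=
    Set.disjoint_left.2 fun ω h0 h1 => h0.2 (openConn_trans'' h1.1 (openConn_symm'' h0.1))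
  have d02 : Disjoint C₀ C₂ := Set.disjoint_left.2 fun ω h0 h2 => h0.2 h2.1
  have d12 : Disjoint C₁ C₂ := Set.disjoint_left.2 fun ω h1 h2 => h1.2 h2.1
  have dA0 : Disjoint A C₀ := Set.disjoint_left.2 fun ω hA' h0 => h0.2 hA'.1
  have dA1 : Disjoint A C₁ := Set.disjoint_left.2 fun ω hA' h1 => h1.2 hA'.1
  have dA2 : Disjoint A C₂ := Set.disjoint_left.2 fun ω hA' h2 => h2.2 hA'.2
  have hU0 : A ∪ C₀ = openConn b c := by
    ext ω
    constructor
    · rintro (hA' | h0)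
      · exact openConn_trans'' (openConn_symm'' hA'.1) hA'.2
      · exact h0.1
    · intro hbc
      by_cases hab : ω ∈ openConn a b
      · exact Or.inl ⟨hab, openConn_trans'' hab hbc⟩
      · exact Or.inr ⟨hbc, hab⟩
  have hU1 : A ∪ C₁ = openConn a c := by
    ext ω
    constructor
    · rintro (hA' | h1)
      · exact hA'.2
      · exact h1.1
    · intro hac
      by_cases hab : ω ∈ openConn a b
      · exact Or.inl ⟨hab, hac⟩
      · exact Or.inr ⟨hac, hab⟩
  have hU2 : A ∪ C₂ = openConn a b := by
    ext ω
    constructor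
    · rintro (hA' | h2)
      · exact hA'.1
      · exact h2.1
    · intro hab
      by_cases hac : ω ∈ openConn a c
      · exact Or.inl ⟨hab, hac⟩
      · exact Or.inr ⟨hab, hac⟩
  have up0 : IsUpperSet (A ∪ C₀) := by rw [hU0]; exact isUpperSet_openConn b c
  have up1 : IsUpperSet (A ∪ C₁) := by rw [hU1]; exact isUpperSet_openConn a c
  have up2 : IsUpperSet (A ∪ C₂) := by rw [hU2]; exact isUpperSet_openConn a b
  have hAup : IsUpperSet A := (isUpperSet_openConn a b).inter (isUpperSet_openConn a c)
  let C : Fin 3 → Set (BondConfig V) := ![C₀, C₁, C₂]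
  have e0 : C 0 = C₀ := rfl
  have e1 : C 1 = C₁ := rfl
  have e2 : C 2 = C₂ := rfl
  have hdisj : ∀ i j : Fin 3, i ≠ j → Disjoint (C i) (C j) := by
    intro i j hij
    fin_cases i <;> fin_cases j
    all_goals first
      | exact (hij rfl).elim
      | exact d01 | exact d01.symm | exact d02 | exact d02.symm | exact d12 | exact d12.symm
  have hdisjA : ∀ i : Fin 3, Disjoint A (C i) := by
    intro i
    fin_cases i
    · exact dA0
    · exact dA1
    · exact dA2
  have hup : ∀ i : Fin 3, IsUpperSet (A ∪ C i) := by
    intro i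
    fin_cases i
    · exact up0
    · exact up1
    · exact up2
  have key := prodBernoulli_strongHarris_cubic_of_sliceStep w hM hdisj hdisjA hup hAup
  have hB : (A ∪ ⋃ i, C i)ᶜ = (openConn a b)ᶜ ∩ (openConn a c)ᶜ ∩ (openConn b c)ᶜ := by
    have h3 : (⋃ i, C i) = C₀ ∪ C₁ ∪ C₂ := by
      ext ω
      simp only [Set.mem_iUnion, Set.mem_union]
      constructor
      · rintro ⟨i, hi⟩
        fin_cases i
        · exact Or.inl (Or.inl hi)
        · exact Or.inl (Or.inr hi)
        · exact Or.inr hi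
      · rintro ((h | h) | h)
        · exact ⟨0, h⟩
        · exact ⟨1, h⟩
        · exact ⟨2, h⟩
    have hunion : A ∪ (C₀ ∪ C₁ ∪ C₂) = openConn a b ∪ openConn a c ∪ openConn b c := by
      rw [← hU0, ← hU1, ← hU2]
      ext ω; simp only [Set.mem_union]; tauto
    rw [h3, hunion]
    ext ω
    simp only [Set.mem_compl_iff, Set.mem_union, not_or, Set.mem_inter_iff]
  rw [hB, e0, e1, e2] at key
  exact key

end Percolation

end StrongHarrisCubicStep

end Summit.CriticalPhenomena.PercolationContinuityZ3.Theorems
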